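import Summits.Ventures.CertifiedArithmetic.LowPrec.SRPythagorasNestedFormats
import Summits.Ventures.CertifiedArithmetic.LowPrec.SRTwoSumExactLaw
import HarnessLib

/-!
# Stochastic rounding in low-precision formats C — the StochasticA whole-range bit threshold
# `emaxCode − 1` is ATTAINED on every binary format (symbolic; binary16, bfloat16, binary32)

HONEST FRAMING: certified error envelopes and provably optimal rounding/accumulation schemes for
low-precision formats under stated cost models; every table by two implementations; no hardware
or vendor claims.

XCVIII (`SRPythagorasAllSigns.valueSet_stochasticA_all`) proves the any-sign Pythagorean law on
the whole range of every format under StochasticA (`probAwayA N`: `N` uniformly random bits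
compared with the truncated residual) as soon as `N ≥ emaxCode − 1`; XCIX
(`SRPythagorasWholeRangeSharp`) checks BY KERNEL, for the five OCP formats, that one bit fewer
breaks drift-antitonicity.  This file proves that threshold witness SYMBOLICALLY for every
`φ : Format` with `3 ≤ φ.emaxCode` and `1 ≤ φ.topMan` (at least two values in the top binade),
so the formats far too large for the kernel are covered: binary16 (`28` bits fail, `29` hold),
bfloat16 and binary32 (`252` fail, `253` hold).

Mechanism (one pattern for all formats).  Let `q = quantum`, `T = 2^(manBits + emaxCode − 1)·q`
(first value of the top binade), `G = 2^(emaxCode − 1)·q` (the spacing there).  From `ŝ₀ = 0`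
the summand `q/2` has the candidates `0, q`; the summand `T + q` then gives the pre-rounding
values `c₁ = T + q` (after the lower candidate) and `c₂ = T + 2q` (after the upper one), both
in the top cell `[T, T + G]`, with residuals `2^-(emaxCode−1)`, `2^-(emaxCode−2)`.  With
`emaxCode − 2` bits `c₁` is rounded DOWN surely (conditional drift `−q`) while `c₂` is rounded
exactly in mean (drift `0`): the remaining drift from the upper candidate `q` EXCEEDS the one
from the lower candidate `0` — not `DriftAntitone`.  With `emaxCode − 1` bits both residuals
are grid points and both drifts vanish.  Everything stays inside `[0, maxRat]` (`InWindow`).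

Main results: `LimitedBits.valueSet_whole_range_threshold_sharp'` (equational form, so that
concrete formats instantiate by `norm_num`) and `LimitedBits.valueSet_whole_range_threshold_sharp`
(direct form over `φ.quantum`, `φ.maxRat`, `φ.emaxCode − 2` / `φ.emaxCode − 1`);
`Formats.binary16_whole_range_threshold_sharp` (`0; 2^-25, 2^15 + 2^-24`: 28 fail / 29 hold),
`Formats.bfloat16_whole_range_threshold_sharp` (`0; 2^-134, 2^127 + 2^-133`: 252 / 253),
`Formats.binary32_whole_range_threshold_sharp` (`0; 2^-150, 2^127 + 2^-149`: 252 / 253).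
With XCVIII: the whole-range StochasticA threshold of EVERY binary format with `emaxCode ≥ 3`,
`topMan ≥ 1` (all catalogued ones) is exactly `emaxCode − 1` bits.
-/


namespace Summit.Ventures.CertifiedArithmetic.LowPrec.SR.LimitedBits

open Literature.ComputerArithmetic.ConnollyHighamMary2021
open Literature.ComputerArithmetic.FloatingPoint (Format MiniFloat)
open Literature.ComputerArithmetic.FloatingPoint.MiniFloat (valueSet valueSet_nonempty toRat_mem_valueSet)
open Summit.Ventures.CertifiedArithmetic.LowPrec.SR
open Finset

/-! ### Two-step trees, unfolded -/

/-- `DriftAntitone` of a two-summand tree is one inequality between the two step means. -/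
theorem driftAntitone_two_iff (F : Finset ℚ) (qf : ℚ → ℚ) (x0 x1 s : ℚ) :
    DriftAntitone F qf (seqL [x0, x1]) 2 s ↔
      stepQ F qf (up F (s + x0) + x1) (fun y => y) - up F (s + x0) ≤
        stepQ F qf (dn F (s + x0) + x1) (fun y => y) - dn F (s + x0) := by
  simp only [DriftAntitone, accExpQ, seqL, List.getD_cons_zero, List.getD_cons_succ, sub_self, le_refl,
    and_true]

/-- `InWindow` of a two-summand tree: the three pre-rounding values lie in the window. -/
theorem inWindow_two_iff (F : Finset ℚ) (lo hi x0 x1 s : ℚ) :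
    InWindow F lo hi (seqL [x0, x1]) 2 s ↔
      (lo ≤ clamp F (s + x0) ∧ clamp F (s + x0) ≤ hi) ∧
        (lo ≤ clamp F (up F (s + x0) + x1) ∧ clamp F (up F (s + x0) + x1) ≤ hi) ∧
          (lo ≤ clamp F (dn F (s + x0) + x1) ∧ clamp F (dn F (s + x0) + x1) ≤ hi) := by
  simp only [InWindow, seqL, List.getD_cons_zero, List.getD_cons_succ, and_true]

/-- The exact up-probability of a point of the hull, as a quotient of candidate distances. -/
theorem pUp_eq_div_of_inHull {F : Finset ℚ} {c : ℚ} (h : InHull F c) :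
    pUp F c = (c - dn F c) / (up F c - dn F c) := by
  unfold pUp dn up probUp; rw [clamp_eq_self h]

/-- The StochasticA step mean on the nonnegative side: `⌊c̄⌋ + A_N(θ)·(⌈c̄⌉ − ⌊c̄⌋)`. -/
theorem stepQ_id_probAwayA {F : Finset ℚ} (N : ℕ) {c : ℚ} (h0 : 0 ≤ dn F c) :
    stepQ F (probAwayA N) c (fun y => y) = dn F c + probAwayA N (pUp F c) * (up F c - dn F c) := by
  unfold stepQ pUpQ; rw [if_pos h0]; ring

/-- `A_N` is exact on grid points `m/2^N`. -/
theorem probAwayA_eq_self_of_grid (N m : ℕ) {η : ℚ} (h : η * 2 ^ N = m) : probAwayA N η = η := by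
  unfold probAwayA
  rw [h, Int.floor_natCast, div_eq_iff (by positivity)]
  push_cast; exact h.symm

/-- `A_b(2^-(b+1)) = 0`: with `b` bits the residual `2^-(b+1)` truncates to zero. -/
theorem probAwayA_half_grid (b : ℕ) : probAwayA b ((1 : ℚ) / 2 ^ (b + 1)) = 0 := by
  unfold probAwayA
  have h : (1 : ℚ) / 2 ^ (b + 1) * 2 ^ b = 1 / 2 := by rw [pow_succ]; field_simp
  have hf : ⌊(1 / 2 : ℚ)⌋ = 0 := by norm_num [Int.floor_eq_iff]
  rw [h, hf]; simp

/-! ### The value set of a format near `0` and in the top binade -/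

variable (φ : Format)

/-- `0` is a value. -/
theorem zero_mem_valueSet' : (0 : ℚ) ∈ valueSet φ := by simpa using toRat_mem_valueSet (MiniFloat.zero φ)

/-- `maxScaled` in closed form when `emaxCode = a + 1`. -/
theorem maxScaled_eq_of_emaxCode {a : ℕ} (ha : φ.emaxCode = a + 1) :
    φ.maxScaled = (2 ^ φ.manBits + φ.topMan) * 2 ^ a := by
  unfold Format.maxScaled; rw [ha, Format.scaled_succ]

/-- The quantum is a value (as soon as there is a normal binade). -/
theorem quantum_mem_valueSet_of_emaxCode {a : ℕ} (ha : φ.emaxCode = a + 1) : φ.quantum ∈ valueSet φ := by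
  have h1 : φ.Representable 1 := by
    refine MiniFloat.representable_of_lt_pow (Nat.one_lt_two_pow (by omega)) ?_
    rw [maxScaled_eq_of_emaxCode φ ha]
    exact Nat.one_le_iff_ne_zero.mpr (by positivity)
  simpa using natMul_mem_of_representable h1

/-- Positive values are at least the quantum. -/
theorem quantum_le_of_mem_pos {v : ℚ} (hv : v ∈ valueSet φ) (h0 : 0 < v) : φ.quantum ≤ v := by
  obtain ⟨n, -, -, hv', -⟩ := exists_natMul_of_mem hv h0.le
  rw [hv'] at h0 ⊢
  have hq := φ.quantum_pos
  have hn : (1 : ℚ) ≤ n := by exact_mod_cast Nat.one_le_iff_ne_zero.mpr (by rintro rfl; simp at h0)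
  simpa using mul_le_mul_of_nonneg_right hn hq.le

/-- The first value `T = 2^(manBits + a)·quantum` of the top binade `a + 1 = emaxCode`. -/
theorem topStart_mem_valueSet {a : ℕ} (ha : φ.emaxCode = a + 1) :
    (2 : ℚ) ^ (φ.manBits + a) * φ.quantum ∈ valueSet φ := by
  have hr : φ.Representable (2 ^ φ.manBits * 2 ^ a) := by
    refine MiniFloat.representable_mul_pow (Nat.pow_lt_pow_right (by norm_num) (by omega)) ?_
    rw [maxScaled_eq_of_emaxCode φ ha]
    exact Nat.mul_le_mul_right _ (Nat.le_add_right _ _)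
  have h := natMul_mem_of_representable hr
  rw [Nat.cast_mul, Nat.cast_pow, Nat.cast_pow, ← pow_add] at h
  exact_mod_cast h

/-- The second value `T + G`, `G = 2^a·quantum`, of the top binade (needs `topMan ≥ 1`). -/
theorem topNext_mem_valueSet {a : ℕ} (ha : φ.emaxCode = a + 1) (ht : 1 ≤ φ.topMan) :
    ((2 : ℚ) ^ (φ.manBits + a) + 2 ^ a) * φ.quantum ∈ valueSet φ := by
  have hM := φ.topMan_lt
  have hr : φ.Representable ((2 ^ φ.manBits + 1) * 2 ^ a) := by
    refine MiniFloat.representable_mul_pow ?_ ?_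
    · have : 2 ^ (φ.manBits + 1) = 2 * 2 ^ φ.manBits := by ring
      omega
    · rw [maxScaled_eq_of_emaxCode φ ha]
      exact Nat.mul_le_mul_right _ (by omega)
  have h := natMul_mem_of_representable hr
  have e : (((2 ^ φ.manBits + 1) * 2 ^ a : ℕ) : ℚ) = 2 ^ (φ.manBits + a) + 2 ^ a := by push_cast; ring
  rwa [e] at h

/-- `T + G ≤ maxRat` (needs `topMan ≥ 1`). -/
theorem topNext_le_maxRat {a : ℕ} (ha : φ.emaxCode = a + 1) (ht : 1 ≤ φ.topMan) :
    ((2 : ℚ) ^ (φ.manBits + a) + 2 ^ a) * φ.quantum ≤ φ.maxRat := by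
  unfold Format.maxRat
  rw [maxScaled_eq_of_emaxCode φ ha]
  refine mul_le_mul_of_nonneg_right ?_ φ.quantum_pos.le
  have : (1 : ℚ) ≤ φ.topMan := by exact_mod_cast ht
  push_cast
  nlinarith [pow_pos (show (0 : ℚ) < 2 by norm_num) a, pow_add (2 : ℚ) φ.manBits a]

/-- TOP-BINADE GAP: a value above `T` is at least `T + G` (a `p`-bit significand above
`2^(manBits + a)` is a multiple of `2^a`). -/
theorem topNext_le_of_mem_gt {a : ℕ} {v : ℚ} (hv : v ∈ valueSet φ)
    (hT : (2 : ℚ) ^ (φ.manBits + a) * φ.quantum < v) :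
    ((2 : ℚ) ^ (φ.manBits + a) + 2 ^ a) * φ.quantum ≤ v := by
  have hq := φ.quantum_pos
  have h0 : 0 ≤ v := le_of_lt (lt_of_le_of_lt (by positivity) hT)
  obtain ⟨n, hrep, -, hv', -⟩ := exists_natMul_of_mem hv h0
  obtain ⟨-, k, j, hk, hnkj⟩ := MiniFloat.representable_iff.mp hrep
  rw [hv'] at hT ⊢
  have hT' : 2 ^ (φ.manBits + a) < n := by
    have : ((2 ^ (φ.manBits + a) : ℕ) : ℚ) < n := by
      push_cast; exact lt_of_mul_lt_mul_right hT hq.le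
    exact_mod_cast this
  have hmain : 2 ^ (φ.manBits + a) + 2 ^ a ≤ n := by
    rcases Nat.lt_or_ge j a with hja | hja
    · exfalso
      have h1 : 2 ^ j ≤ 2 ^ (a - 1) := Nat.pow_le_pow_right (by norm_num) (by omega)
      have h2 : n < 2 ^ (φ.manBits + a) :=
        calc n = k * 2 ^ j := hnkj
          _ ≤ k * 2 ^ (a - 1) := Nat.mul_le_mul_left k h1
          _ < 2 ^ (φ.manBits + 1) * 2 ^ (a - 1) := mul_lt_mul_of_pos_right hk (by positivity)
          _ = 2 ^ (φ.manBits + a) := by rw [← pow_add]; congr 1; omega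
      omega
    · have hj : 2 ^ j = 2 ^ (j - a) * 2 ^ a := by rw [← pow_add]; congr 1; omega
      have hn : n = (k * 2 ^ (j - a)) * 2 ^ a := by rw [hnkj, hj, mul_assoc]
      have hTa : 2 ^ (φ.manBits + a) = 2 ^ φ.manBits * 2 ^ a := pow_add 2 _ a
      rw [hn, hTa] at hT' ⊢
      have hlt : 2 ^ φ.manBits < k * 2 ^ (j - a) := lt_of_mul_lt_mul_right hT' (Nat.zero_le _)
      calc 2 ^ φ.manBits * 2 ^ a + 2 ^ a = (2 ^ φ.manBits + 1) * 2 ^ a := by ring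
        _ ≤ (k * 2 ^ (j - a)) * 2 ^ a := Nat.mul_le_mul_right _ hlt
  have hc : ((2 ^ (φ.manBits + a) + 2 ^ a : ℕ) : ℚ) ≤ n := by exact_mod_cast hmain
  calc ((2 : ℚ) ^ (φ.manBits + a) + 2 ^ a) * φ.quantum
      = ((2 ^ (φ.manBits + a) + 2 ^ a : ℕ) : ℚ) * φ.quantum := by push_cast; ring
    _ ≤ n * φ.quantum := mul_le_mul_of_nonneg_right hc hq.le

/-! ### The candidates of the three pre-rounding values -/

/-- `⌊q/2⌋ = 0`. -/
theorem dn_half_quantum {a : ℕ} (ha : φ.emaxCode = a + 1) : dn (valueSet φ) (φ.quantum / 2) = 0 := by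
  have hq := φ.quantum_pos
  have hqm := quantum_mem_valueSet_of_emaxCode φ ha
  have hin : InHull (valueSet φ) (φ.quantum / 2) :=
    ⟨⟨0, zero_mem_valueSet' φ, by positivity⟩, ⟨φ.quantum, hqm, by linarith⟩⟩
  unfold dn; rw [clamp_eq_self hin]
  have hmem : roundDown (valueSet φ) (φ.quantum / 2) ∈ valueSet φ :=
    roundDown_mem ⟨0, zero_mem_valueSet' φ, by positivity⟩
  have hle : roundDown (valueSet φ) (φ.quantum / 2) ≤ φ.quantum / 2 := roundDown_le _ _
  have hge : 0 ≤ roundDown (valueSet φ) (φ.quantum / 2) := le_roundDown_of_mem (zero_mem_valueSet' φ) (by positivity)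
  by_contra hne
  have := quantum_le_of_mem_pos φ hmem (lt_of_le_of_ne hge (Ne.symm hne))
  linarith

/-- `⌈q/2⌉ = q`. -/
theorem up_half_quantum {a : ℕ} (ha : φ.emaxCode = a + 1) :
    up (valueSet φ) (φ.quantum / 2) = φ.quantum := by
  have hq := φ.quantum_pos
  have hqm := quantum_mem_valueSet_of_emaxCode φ ha
  have hin : InHull (valueSet φ) (φ.quantum / 2) :=
    ⟨⟨0, zero_mem_valueSet' φ, by positivity⟩, ⟨φ.quantum, hqm, by linarith⟩⟩
  unfold up; rw [clamp_eq_self hin]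
  have hmem : roundUp (valueSet φ) (φ.quantum / 2) ∈ valueSet φ := roundUp_mem ⟨φ.quantum, hqm, by linarith⟩
  have hge : φ.quantum / 2 ≤ roundUp (valueSet φ) (φ.quantum / 2) := le_roundUp _ _
  have hle : roundUp (valueSet φ) (φ.quantum / 2) ≤ φ.quantum := roundUp_le_of_mem hqm (by linarith)
  exact le_antisymm hle (quantum_le_of_mem_pos φ hmem (by linarith))

/-- Inside the top cell `(T, T + G)`: `⌊c̄⌋ = T`. -/
theorem dn_topCell {a : ℕ} (ha : φ.emaxCode = a + 1) (ht : 1 ≤ φ.topMan) {c : ℚ}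
    (hTc : (2 : ℚ) ^ (φ.manBits + a) * φ.quantum < c)
    (hcT : c < ((2 : ℚ) ^ (φ.manBits + a) + 2 ^ a) * φ.quantum) :
    dn (valueSet φ) c = (2 : ℚ) ^ (φ.manBits + a) * φ.quantum := by
  have hTm := topStart_mem_valueSet φ ha
  have hin : InHull (valueSet φ) c := ⟨⟨_, hTm, hTc.le⟩, ⟨_, topNext_mem_valueSet φ ha ht, hcT.le⟩⟩
  unfold dn; rw [clamp_eq_self hin]
  have hmem : roundDown (valueSet φ) c ∈ valueSet φ := roundDown_mem ⟨_, hTm, hTc.le⟩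
  have hge := le_roundDown_of_mem hTm hTc.le
  have hle : roundDown (valueSet φ) c ≤ c := roundDown_le _ _
  by_contra hne
  have := topNext_le_of_mem_gt φ hmem (lt_of_le_of_ne hge (Ne.symm hne))
  linarith

/-- Inside the top cell `(T, T + G)`: `⌈c̄⌉ = T + G`. -/
theorem up_topCell {a : ℕ} (ha : φ.emaxCode = a + 1) (ht : 1 ≤ φ.topMan) {c : ℚ}
    (hTc : (2 : ℚ) ^ (φ.manBits + a) * φ.quantum < c)
    (hcT : c < ((2 : ℚ) ^ (φ.manBits + a) + 2 ^ a) * φ.quantum) :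
    up (valueSet φ) c = ((2 : ℚ) ^ (φ.manBits + a) + 2 ^ a) * φ.quantum := by
  have hTm := topStart_mem_valueSet φ ha
  have hNm := topNext_mem_valueSet φ ha ht
  have hin : InHull (valueSet φ) c := ⟨⟨_, hTm, hTc.le⟩, ⟨_, hNm, hcT.le⟩⟩
  unfold up; rw [clamp_eq_self hin]
  have hmem : roundUp (valueSet φ) c ∈ valueSet φ := roundUp_mem ⟨_, hNm, hcT.le⟩
  have hge : c ≤ roundUp (valueSet φ) c := le_roundUp _ _
  have hle := roundUp_le_of_mem hNm hcT.le
  exact le_antisymm hle (topNext_le_of_mem_gt φ hmem (lt_of_lt_of_le hTc hge))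

/-! ### The threshold witness -/

/-- **The whole-range StochasticA threshold `emaxCode − 1` is attained on every binary format**
(equational form, ready for instantiation).  For `φ` with `emaxCode = b + 2 ≥ 3` and `topMan ≥ 1`,
writing `xq = quantum/2`, `c = T + quantum` with `T = 2^(manBits + b + 1)·quantum` and `hi = maxRat`:
the two-summand tree `0; xq, c` stays in `[0, hi]`, is NOT drift-antitone under `A_b`
(`b = emaxCode − 2` bits) and IS drift-antitone under `A_(b+1)`. -/
theorem valueSet_whole_range_threshold_sharp' {b : ℕ} (hb : φ.emaxCode = b + 2) (hb1 : 1 ≤ b)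
    (ht : 1 ≤ φ.topMan) {xq c hi : ℚ} (hxq : φ.quantum / 2 = xq)
    (hc : ((2 : ℚ) ^ (φ.manBits + (b + 1)) + 1) * φ.quantum = c) (hhi : φ.maxRat = hi) :
    InWindow (valueSet φ) 0 hi (seqL [xq, c]) 2 0 ∧
      ¬ DriftAntitone (valueSet φ) (probAwayA b) (seqL [xq, c]) 2 0 ∧
        DriftAntitone (valueSet φ) (probAwayA (b + 1)) (seqL [xq, c]) 2 0 := by
  subst hxq hc hhi
  have ha : φ.emaxCode = (b + 1) + 1 := by omega
  have hq := φ.quantum_pos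
  have hTm := topStart_mem_valueSet φ ha
  have hNm := topNext_mem_valueSet φ ha ht
  have hNle := topNext_le_maxRat φ ha ht
  have hqm := quantum_mem_valueSet_of_emaxCode φ ha
  have h0m := zero_mem_valueSet' φ
  have hup0' := up_half_quantum φ ha
  have hdn0' := dn_half_quantum φ ha
  set q := φ.quantum with hq_def
  set T : ℚ := 2 ^ (φ.manBits + (b + 1)) * q with hT_def
  set G : ℚ := 2 ^ (b + 1) * q with hG_def
  have hTG : ((2 : ℚ) ^ (φ.manBits + (b + 1)) + 2 ^ (b + 1)) * q = T + G := by
    rw [hT_def, hG_def]; ring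
  have hT0 : 0 ≤ T := by positivity
  have hG2 : 2 * q < G := by
    have h4 : (2 : ℚ) ^ 2 ≤ 2 ^ (b + 1) := pow_le_pow_right₀ (by norm_num) (by omega)
    exact mul_lt_mul_of_pos_right (lt_of_lt_of_le (by norm_num) h4) hq
  -- the three pre-rounding values
  have hup0 : up (valueSet φ) (0 + q / 2) = q := by rw [zero_add]; exact hup0'
  have hdn0 : dn (valueSet φ) (0 + q / 2) = 0 := by rw [zero_add]; exact hdn0'
  have hc1 : (0 : ℚ) + (2 ^ (φ.manBits + (b + 1)) + 1) * q = T + q := by rw [hT_def]; ring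
  have hc2 : q + (2 ^ (φ.manBits + (b + 1)) + 1) * q = T + 2 * q := by rw [hT_def]; ring
  have hmax : T + G ≤ φ.maxRat := by rw [← hTG]; exact hNle
  -- candidates in the top cell
  have cell : ∀ {y : ℚ}, T < y → y < T + G →
      dn (valueSet φ) y = T ∧ up (valueSet φ) y = T + G ∧ InHull (valueSet φ) y := by
    intro y h1 h2
    have h2' : y < ((2 : ℚ) ^ (φ.manBits + (b + 1)) + 2 ^ (b + 1)) * q := by rwa [hTG]
    refine ⟨dn_topCell φ ha ht h1 h2', by rw [up_topCell φ ha ht h1 h2', hTG], ?_⟩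
    exact ⟨⟨_, hTm, h1.le⟩, ⟨_, hNm, h2'.le⟩⟩
  obtain ⟨d1, u1, in1⟩ := cell (y := T + q) (by linarith) (by linarith)
  obtain ⟨d2, u2, in2⟩ := cell (y := T + 2 * q) (by linarith) (by linarith)
  have p1 : pUp (valueSet φ) (T + q) = 1 / 2 ^ (b + 1) := by
    rw [pUp_eq_div_of_inHull in1, d1, u1, hG_def]; field_simp; ring
  have p2 : pUp (valueSet φ) (T + 2 * q) = 1 / 2 ^ b := by
    rw [pUp_eq_div_of_inHull in2, d2, u2, hG_def, pow_succ]; field_simp; ring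
  -- step means
  have s1b : stepQ (valueSet φ) (probAwayA b) (T + q) (fun y => y) = T := by
    rw [stepQ_id_probAwayA b (by rw [d1]; exact hT0), p1, probAwayA_half_grid, d1]; ring
  have s1b1 : stepQ (valueSet φ) (probAwayA (b + 1)) (T + q) (fun y => y) = T + q := by
    rw [stepQ_id_probAwayA (b + 1) (by rw [d1]; exact hT0), p1,
      probAwayA_eq_self_of_grid (b + 1) 1 (by push_cast; field_simp), d1, u1, hG_def]
    field_simp; ring
  have s2b : stepQ (valueSet φ) (probAwayA b) (T + 2 * q) (fun y => y) = T + 2 * q := by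
    rw [stepQ_id_probAwayA b (by rw [d2]; exact hT0), p2,
      probAwayA_eq_self_of_grid b 1 (by push_cast; field_simp), d2, u2, hG_def, pow_succ]
    field_simp; ring
  have s2b1 : stepQ (valueSet φ) (probAwayA (b + 1)) (T + 2 * q) (fun y => y) = T + 2 * q := by
    rw [stepQ_id_probAwayA (b + 1) (by rw [d2]; exact hT0), p2,
      probAwayA_eq_self_of_grid (b + 1) 2 (by push_cast; rw [pow_succ]; field_simp), d2, u2, hG_def,
      pow_succ]
    field_simp; ring
  have hin0 : InHull (valueSet φ) (q / 2) := ⟨⟨0, h0m, by positivity⟩, ⟨q, hqm, by linarith⟩⟩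
  refine ⟨?_, ?_, ?_⟩
  · rw [inWindow_two_iff, hup0, hdn0, hc1, hc2, zero_add, clamp_eq_self hin0, clamp_eq_self in1,
      clamp_eq_self in2]
    exact ⟨⟨by positivity, by linarith⟩, ⟨by positivity, by linarith⟩, ⟨by positivity, by linarith⟩⟩
  · rw [driftAntitone_two_iff, hup0, hdn0, hc1, hc2, s2b, s1b]
    intro h; linarith
  · rw [driftAntitone_two_iff, hup0, hdn0, hc1, hc2, s2b1, s1b1]
    linarith

/-- **The whole-range StochasticA threshold `emaxCode − 1` is attained** (direct form): for every
format with `3 ≤ emaxCode` and `1 ≤ topMan`, the tree `0; quantum/2, 2^(manBits+emaxCode−1)·quantum +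
quantum` is in the window `[0, maxRat]`, not drift-antitone with `emaxCode − 2` bits, drift-antitone
with `emaxCode − 1` bits.  (XCVIII: `emaxCode − 1` bits give the Pythagorean law on the whole range.) -/
theorem valueSet_whole_range_threshold_sharp (he : 3 ≤ φ.emaxCode) (ht : 1 ≤ φ.topMan) :
    InWindow (valueSet φ) 0 φ.maxRat
        (seqL [φ.quantum / 2, ((2 : ℚ) ^ (φ.manBits + (φ.emaxCode - 1)) + 1) * φ.quantum]) 2 0 ∧
      ¬ DriftAntitone (valueSet φ) (probAwayA (φ.emaxCode - 2))
        (seqL [φ.quantum / 2, ((2 : ℚ) ^ (φ.manBits + (φ.emaxCode - 1)) + 1) * φ.quantum]) 2 0 ∧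
      DriftAntitone (valueSet φ) (probAwayA (φ.emaxCode - 1))
        (seqL [φ.quantum / 2, ((2 : ℚ) ^ (φ.manBits + (φ.emaxCode - 1)) + 1) * φ.quantum]) 2 0 := by
  obtain ⟨b, hb⟩ : ∃ b, φ.emaxCode = b + 2 := ⟨φ.emaxCode - 2, by omega⟩
  have e1 : φ.emaxCode - 1 = b + 1 := by omega
  have e2 : φ.emaxCode - 2 = b := by omega
  rw [e1, e2]
  exact valueSet_whole_range_threshold_sharp' φ hb (by omega) ht rfl rfl rfl

end Summit.Ventures.CertifiedArithmetic.LowPrec.SR.LimitedBits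

/-! ### The IEEE-style formats too large for the kernel -/

namespace Summit.Ventures.CertifiedArithmetic.LowPrec.SR.Formats

open Literature.ComputerArithmetic.FloatingPoint
open Literature.ComputerArithmetic.FloatingPoint.MiniFloat (valueSet)
open Summit.Ventures.CertifiedArithmetic.LowPrec.SR LimitedBits

/-- **binary16**: from `0`, summands `2^-25` then `2^15 + 2^-24` (window `[0, 65504]`): StochasticA
with `28` bits is not drift-antitone, with `29` bits it is — the whole-range threshold
`emaxCode − 1 = 29` of XCVIII is attained. -/
theorem binary16_whole_range_threshold_sharp :
    InWindow (valueSet Format.Binary16) 0 65504 (seqL [1 / 2 ^ 25, 2 ^ 15 + 1 / 2 ^ 24]) 2 0 ∧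
      ¬ DriftAntitone (valueSet Format.Binary16) (probAwayA 28) (seqL [1 / 2 ^ 25, 2 ^ 15 + 1 / 2 ^ 24]) 2 0 ∧
      DriftAntitone (valueSet Format.Binary16) (probAwayA 29) (seqL [1 / 2 ^ 25, 2 ^ 15 + 1 / 2 ^ 24]) 2 0 :=
  valueSet_whole_range_threshold_sharp' Format.Binary16 rfl (by norm_num) (by decide)
    (by rw [Format.Binary16_maxRat.2]; norm_num) (by rw [Format.Binary16_maxRat.2]; norm_num [Format.Binary16])
    Format.Binary16_maxRat.1

set_option exponentiation.threshold 1024 in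
/-- **bfloat16**: from `0`, summands `2^-134` then `2^127 + 2^-133` (window `[0, (2^8−1)·2^120]`):
`252` bits fail, `253 = emaxCode − 1` hold. -/
theorem bfloat16_whole_range_threshold_sharp :
    InWindow (valueSet Format.BFloat16) 0 ((2 ^ 8 - 1) * 2 ^ 120)
        (seqL [1 / 2 ^ 134, 2 ^ 127 + 1 / 2 ^ 133]) 2 0 ∧
      ¬ DriftAntitone (valueSet Format.BFloat16) (probAwayA 252)
        (seqL [1 / 2 ^ 134, 2 ^ 127 + 1 / 2 ^ 133]) 2 0 ∧
      DriftAntitone (valueSet Format.BFloat16) (probAwayA 253)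
        (seqL [1 / 2 ^ 134, 2 ^ 127 + 1 / 2 ^ 133]) 2 0 :=
  valueSet_whole_range_threshold_sharp' Format.BFloat16 rfl (by norm_num) (by decide)
    (by rw [Format.BFloat16_maxRat.2]; norm_num) (by rw [Format.BFloat16_maxRat.2]; norm_num [Format.BFloat16])
    Format.BFloat16_maxRat.1

set_option exponentiation.threshold 1024 in
/-- **binary32**: from `0`, summands `2^-150` then `2^127 + 2^-149` (window `[0, (2^24−1)·2^104]`):
`252` bits fail, `253 = emaxCode − 1` hold. -/
theorem binary32_whole_range_threshold_sharp :
    InWindow (valueSet Format.Binary32) 0 ((2 ^ 24 - 1) * 2 ^ 104)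
        (seqL [1 / 2 ^ 150, 2 ^ 127 + 1 / 2 ^ 149]) 2 0 ∧
      ¬ DriftAntitone (valueSet Format.Binary32) (probAwayA 252)
        (seqL [1 / 2 ^ 150, 2 ^ 127 + 1 / 2 ^ 149]) 2 0 ∧
      DriftAntitone (valueSet Format.Binary32) (probAwayA 253)
        (seqL [1 / 2 ^ 150, 2 ^ 127 + 1 / 2 ^ 149]) 2 0 :=
  valueSet_whole_range_threshold_sharp' Format.Binary32 rfl (by norm_num) (by decide)
    (by rw [Format.Binary32_maxRat.2]; norm_num) (by rw [Format.Binary32_maxRat.2]; norm_num [Format.Binary32])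
    Format.Binary32_maxRat.1

end Summit.Ventures.CertifiedArithmetic.LowPrec.SR.Formats
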